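import Literature.NumberTheory.Sieve.IwaniecAlmostPrimesRootExpSum
import HarnessLib

/-!
# Bilinear forms with Kloosterman fractions: tools for the `n₂`-sums of the off-diagonal pairs

Topic `NumberTheory/LFunctions`.  Elementary tools for the off-diagonal analysis of
Bettin–Chandee, *Trilinear forms with Kloosterman fractions*, Adv. Math. 328 (2018), §4.1.3
(Duke–Friedlander–Iwaniec, Invent. Math. 128 (1997), §4), where for a pair `(ℓ₁,d),(ℓ₁',d')`
the variable `n₂` "runs over a finite union of intervals of length at most `O(N/(𝔮₁𝔮₂))`, with
a congruence condition modulo `b𝔮₁𝔭₂[d,d']η`", the twist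
"`ϑa₂(dℓ̃₁'-d'ℓ̃₁)/(bℓ̃₁ℓ̃₁'𝔭₁n₁'𝔮₁𝔮₂n₂') ≪ |ϑ|AD/(bLN²)`" being removed "by using partial
summation":

* `kfw_convex_filter_eq_Ioc`, `kfw_affine_convex` — an order-convex condition (such as
  `M₁ < (ℓ₁n₁ - ℓ₂n₂)/d ≤ M₂`) cuts an integer interval out of an integer interval;
* `kfw_dcond_iff` — `(d ∣ w ∧ M₁ < w/d ≤ M₂ ∧ w/d ≡ c (b)) ↔ (M₁ < w/d ≤ M₂ over ℝ ∧ b|d| ∣ w - cd)`;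
  `kfw_lin_cong_iff` — `q ∣ A - ℓn ↔ n ≡ ℓ̄A (mod q)`; `kfw_two_cong_iff` — two compatible
  congruences are one modulo the lcm;
* `kfw_abel_bound` — Abel summation over a filtered integer interval (from the tree's
  `norm_sum_mul_le_of_partialSums`), `kfw_twist_variation` — `‖e(θ/(n+1)) - e(θ/n)‖ ≤ 2π|θ|(1/n - 1/(n+1))`.

## References

* S. Bettin, V. Chandee, Adv. Math. 328 (2018) 1234–1262 (arXiv:1502.00769), §4.1.3 (gwp) and
  the display after (afed). [BettinChandee2018]
* W. Duke, J. Friedlander, H. Iwaniec, Invent. Math. 128 (1997) 23–43. [DukeFriedlanderIwaniec1997]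
-/

noncomputable section

open Finset

namespace Literature.NumberTheory.LFunctions

/-! ### Order-convex subsets of an integer interval are integer intervals -/

/-- A subset of `(N₁, N₂] ∩ ℤ` cut out by an order-convex predicate is `(x₁, x₂] ∩ ℤ` for some
`N₁ ≤ x₁ ≤ x₂ ≤ N₂`. [folklore] -/
theorem kfw_convex_filter_eq_Ioc {N₁ N₂ : ℤ} (hN : N₁ ≤ N₂) (P : ℤ → Prop) [DecidablePred P]
    (hP : ∀ a b c : ℤ, a ≤ b → b ≤ c → P a → P c → P b) :
    ∃ x₁ x₂ : ℤ, N₁ ≤ x₁ ∧ x₁ ≤ x₂ ∧ x₂ ≤ N₂ ∧ (Ioc N₁ N₂).filter P = Ioc x₁ x₂ := by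
  by_cases hne : ((Ioc N₁ N₂).filter P).Nonempty
  · set m := ((Ioc N₁ N₂).filter P).min' hne with hm
    set M := ((Ioc N₁ N₂).filter P).max' hne with hM
    have hmmem : m ∈ (Ioc N₁ N₂).filter P := Finset.min'_mem _ hne
    have hMmem : M ∈ (Ioc N₁ N₂).filter P := Finset.max'_mem _ hne
    rw [Finset.mem_filter, Finset.mem_Ioc] at hmmem hMmem
    refine ⟨m - 1, M, by omega, ?_, hMmem.1.2, ?_⟩
    · have := Finset.min'_le _ _ (Finset.max'_mem _ hne)
      rw [← hm, ← hM] at this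
      omega
    · ext n
      simp only [Finset.mem_filter, Finset.mem_Ioc]
      constructor
      · intro hn
        have h1 := Finset.min'_le _ n (Finset.mem_filter.mpr ⟨Finset.mem_Ioc.mpr hn.1, hn.2⟩)
        have h2 := Finset.le_max' _ n (Finset.mem_filter.mpr ⟨Finset.mem_Ioc.mpr hn.1, hn.2⟩)
        rw [← hm] at h1; rw [← hM] at h2
        omega
      · intro hn
        refine ⟨⟨by omega, by omega⟩, ?_⟩
        exact hP m n M (by omega) hn.2 hmmem.2 hMmem.2
  · refine ⟨N₁, N₁, le_rfl, le_rfl, hN, ?_⟩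
    rw [Finset.not_nonempty_iff_eq_empty] at hne
    rw [hne, Finset.Ioc_self]

/-- The real condition `M₁ < (A - ℓ n)/d ≤ M₂` (`d ≠ 0`) is order-convex in `n`. [folklore] -/
theorem kfw_affine_convex (A ℓ d M₁ M₂ : ℝ) (hd : d ≠ 0) :
    ∀ a b c : ℤ, a ≤ b → b ≤ c →
      (M₁ < (A - ℓ * a) / d ∧ (A - ℓ * a) / d ≤ M₂) →
      (M₁ < (A - ℓ * c) / d ∧ (A - ℓ * c) / d ≤ M₂) →
      (M₁ < (A - ℓ * b) / d ∧ (A - ℓ * b) / d ≤ M₂) := by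
  intro a b c hab hbc ha hc
  have hab' : (a : ℝ) ≤ b := by exact_mod_cast hab
  have hbc' : (b : ℝ) ≤ c := by exact_mod_cast hbc
  -- `(A - ℓ b)/d` lies between `(A - ℓ a)/d` and `(A - ℓ c)/d`
  have key : ∀ x y z : ℝ, x ≤ y → y ≤ z →
      min ((A - ℓ * x) / d) ((A - ℓ * z) / d) ≤ (A - ℓ * y) / d ∧
        (A - ℓ * y) / d ≤ max ((A - ℓ * x) / d) ((A - ℓ * z) / d) := by
    intro x y z hxy hyz
    rcases lt_or_gt_of_ne hd with hd' | hd'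
    · rcases le_total 0 ℓ with hℓ | hℓ
      · -- `d < 0`, `ℓ ≥ 0`: the map is increasing
        have h1 : (A - ℓ * x) / d ≤ (A - ℓ * y) / d :=
          div_le_div_of_nonpos_of_le hd'.le (by nlinarith)
        have h2 : (A - ℓ * y) / d ≤ (A - ℓ * z) / d :=
          div_le_div_of_nonpos_of_le hd'.le (by nlinarith)
        exact ⟨le_trans (min_le_left _ _) h1, le_trans h2 (le_max_right _ _)⟩
      · have h1 : (A - ℓ * y) / d ≤ (A - ℓ * x) / d :=
          div_le_div_of_nonpos_of_le hd'.le (by nlinarith)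
        have h2 : (A - ℓ * z) / d ≤ (A - ℓ * y) / d :=
          div_le_div_of_nonpos_of_le hd'.le (by nlinarith)
        exact ⟨le_trans (min_le_right _ _) h2, le_trans h1 (le_max_left _ _)⟩
    · rcases le_total 0 ℓ with hℓ | hℓ
      · -- `d > 0`, `ℓ ≥ 0`: decreasing
        have h1 : (A - ℓ * y) / d ≤ (A - ℓ * x) / d :=
          div_le_div_of_nonneg_right (by nlinarith) hd'.le
        have h2 : (A - ℓ * z) / d ≤ (A - ℓ * y) / d :=
          div_le_div_of_nonneg_right (by nlinarith) hd'.le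
        exact ⟨le_trans (min_le_right _ _) h2, le_trans h1 (le_max_left _ _)⟩
      · have h1 : (A - ℓ * x) / d ≤ (A - ℓ * y) / d :=
          div_le_div_of_nonneg_right (by nlinarith) hd'.le
        have h2 : (A - ℓ * y) / d ≤ (A - ℓ * z) / d :=
          div_le_div_of_nonneg_right (by nlinarith) hd'.le
        exact ⟨le_trans (min_le_left _ _) h1, le_trans h2 (le_max_right _ _)⟩
  obtain ⟨k1, k2⟩ := key a b c hab' hbc'
  constructor
  · exact lt_of_lt_of_le (lt_min ha.1 hc.1) k1
  · exact le_trans k2 (max_le ha.2 hc.2)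

/-! ### The `d`-conditions as a real interval and a congruence -/

/-- For `d ≠ 0`, `b` and an integer `w`:
`(d ∣ w ∧ M₁ < w/d ≤ M₂ ∧ w/d ≡ c (mod b)) ↔ ((M₁ < w/d ≤ M₂ over ℝ) ∧ b|d| ∣ w - cd)`.
[folklore] -/
theorem kfw_dcond_iff {d : ℤ} (hd : d ≠ 0) (b : ℕ) (w c M₁ M₂ : ℤ) :
    (d ∣ w ∧ M₁ < w / d ∧ w / d ≤ M₂ ∧ w / d ≡ c [ZMOD b]) ↔
      (((M₁ : ℝ) < (w : ℝ) / d ∧ (w : ℝ) / d ≤ M₂) ∧ ((b : ℤ) * |d|) ∣ w - c * d) := by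
  have hd' : (d : ℝ) ≠ 0 := by exact_mod_cast hd
  -- `b|d| ∣ X ↔ b d ∣ X`
  have habs : ∀ X : ℤ, ((b : ℤ) * |d|) ∣ X ↔ ((b : ℤ) * d) ∣ X := by
    intro X
    rcases abs_choice d with h | h
    · rw [h]
    · rw [h, mul_neg, neg_dvd]
  constructor
  · rintro ⟨⟨m, rfl⟩, h1, h2, h3⟩
    rw [Int.mul_ediv_cancel_left _ hd] at h1 h2 h3
    have hreal : ((d * m : ℤ) : ℝ) / d = (m : ℝ) := by push_cast; field_simp
    refine ⟨⟨?_, ?_⟩, ?_⟩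
    · rw [hreal]; exact_mod_cast h1
    · rw [hreal]; exact_mod_cast h2
    · rw [habs]
      have h4 : (b : ℤ) ∣ m - c := by
        have := (Int.modEq_iff_dvd.mp h3.symm)
        simpa using this
      have : d * m - c * d = d * (m - c) := by ring
      rw [this, mul_comm (b : ℤ) d]
      exact mul_dvd_mul_left d h4
  · rintro ⟨⟨h1, h2⟩, h3⟩
    rw [habs] at h3
    have hdw : d ∣ w := by
      have h4 : d ∣ w - c * d := (dvd_mul_left d (b : ℤ)).trans h3
      have h5 : d ∣ c * d := dvd_mul_left d c
      have : w = (w - c * d) + c * d := by ring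
      rw [this]; exact dvd_add h4 h5
    obtain ⟨m, rfl⟩ := hdw
    rw [Int.mul_ediv_cancel_left _ hd]
    have hreal : ((d * m : ℤ) : ℝ) / d = (m : ℝ) := by push_cast; field_simp
    rw [hreal] at h1 h2
    refine ⟨dvd_mul_right d m, by exact_mod_cast h1, by exact_mod_cast h2, ?_⟩
    have h4 : (b : ℤ) * d ∣ (m - c) * d := by
      have : d * m - c * d = (m - c) * d := by ring
      rwa [this] at h3
    have h5 : (b : ℤ) ∣ m - c := Int.dvd_of_mul_dvd_mul_right hd h4
    exact Int.modEq_iff_dvd.mpr (by simpa using h5.neg_right)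

/-- Solving the linear congruence: for `q ≥ 1`, `(ℓ, q) = 1` and integers `A, n`,
`q ∣ A - ℓ n ↔ n ≡ v (mod q)` with `v = ℓ̄ A (mod q)`. [folklore] -/
theorem kfw_lin_cong_iff {q : ℕ} (hq : 0 < q) {ℓ : ℕ} (hℓ : ℓ.Coprime q) (A n : ℤ) :
    ((q : ℤ) ∣ A - ℓ * n) ↔
      n ≡ ((((ℓ : ZMod q)⁻¹ * (A : ZMod q)).val : ℕ) : ℤ) [ZMOD q] := by
  haveI : NeZero q := ⟨hq.ne'⟩
  have hu : IsUnit ((ℓ : ℕ) : ZMod q) := (ZMod.isUnit_iff_coprime ℓ q).mpr hℓ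
  rw [← ZMod.intCast_eq_intCast_iff, Int.cast_natCast, ZMod.natCast_zmod_val,
    ← ZMod.intCast_eq_intCast_iff_dvd_sub]
  push_cast
  constructor
  · intro h
    -- `ℓ n = A` ⟹ `n = ℓ⁻¹ A`
    calc (n : ZMod q) = ((ℓ : ZMod q)⁻¹ * (ℓ : ZMod q)) * (n : ZMod q) := by
          rw [ZMod.inv_mul_of_unit _ hu, one_mul]
      _ = (ℓ : ZMod q)⁻¹ * (A : ZMod q) := by rw [mul_assoc, h]
  · intro h
    rw [h, ← mul_assoc, ZMod.mul_inv_of_unit _ hu, one_mul]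

/-- Two congruences with a common solution `x₀` are one congruence modulo the lcm. [folklore] -/
theorem kfw_two_cong_iff {M M' : ℕ} {v v' x₀ : ℤ} (h₀ : x₀ ≡ v [ZMOD M]) (h₀' : x₀ ≡ v' [ZMOD M'])
    (n : ℤ) :
    (n ≡ v [ZMOD M] ∧ n ≡ v' [ZMOD M']) ↔ n ≡ x₀ [ZMOD (Nat.lcm M M' : ℕ)] := by
  have e1 : n ≡ v [ZMOD M] ↔ n ≡ x₀ [ZMOD M] :=
    ⟨fun h => h.trans h₀.symm, fun h => h.trans h₀⟩
  have e2 : n ≡ v' [ZMOD M'] ↔ n ≡ x₀ [ZMOD M'] :=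
    ⟨fun h => h.trans h₀'.symm, fun h => h.trans h₀'⟩
  rw [e1, e2, Int.modEq_iff_dvd, Int.modEq_iff_dvd, Int.modEq_iff_dvd, Int.natCast_dvd,
    Int.natCast_dvd, Int.natCast_dvd]
  constructor
  · rintro ⟨h1, h2⟩; exact Nat.lcm_dvd h1 h2
  · intro h; exact ⟨(Nat.dvd_lcm_left M M').trans h, (Nat.dvd_lcm_right M M').trans h⟩

/-! ### Partial summation against a slowly varying twist -/

/-- Reindexing a filtered sum over `(x₁, x₁ + K]` as a sum over `range K`. [folklore] -/
theorem kfw_sum_Ioc_filter_eq_sum_range (x₁ : ℤ) (K : ℕ) (p : ℤ → Prop) [DecidablePred p]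
    (h : ℤ → ℂ) :
    ∑ n ∈ (Ioc x₁ (x₁ + K)).filter p, h n =
      ∑ i ∈ Finset.range K, (if p (x₁ + 1 + i) then h (x₁ + 1 + i) else 0) := by
  rw [Finset.sum_filter]
  set rr : ℕ → ℤ := fun i => x₁ + 1 + (i : ℤ) with hrr
  have hIoc : Finset.Ioc x₁ (x₁ + K) = (Finset.range K).map ⟨rr, fun i j hij => by
      simp only [hrr] at hij; exact_mod_cast (add_left_cancel hij)⟩ := by
    ext m
    simp only [Finset.mem_Ioc, Finset.mem_map, Finset.mem_range, Function.Embedding.coeFn_mk, hrr]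
    constructor
    · rintro ⟨h1, h2⟩
      refine ⟨(m - x₁ - 1).toNat, ?_, ?_⟩ <;> omega
    · rintro ⟨n, hn, rfl⟩; omega
  rw [hIoc, Finset.sum_map]
  rfl

/-- **Abel summation** for a filtered sum over an integer interval: if all the partial sums
`∑_{x₁ < n ≤ t, p n} g(n)` have norm `≤ B` (`B ≥ 0`), `‖f‖ ≤ 1`, and
`‖f(n+1) - f(n)‖ ≤ φ(n) - φ(n+1)` for `x₁ < n` with `φ` nonincreasing... precisely with a
telescoping majorant, then `‖∑_{x₁ < n ≤ x₂, p n} g(n) f(n)‖ ≤ B (1 + (φ(x₁+1) - φ(x₂)))`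
(`x₂ = x₁ + K`, `K ≥ 1`).
[folklore] -/
theorem kfw_abel_bound (x₁ : ℤ) {K : ℕ} (hK : 1 ≤ K) (p : ℤ → Prop) [DecidablePred p]
    (g f : ℤ → ℂ) (φ : ℤ → ℝ) {B : ℝ} (hB : 0 ≤ B)
    (hpartial : ∀ k : ℕ, k ≤ K → ‖∑ n ∈ (Ioc x₁ (x₁ + k)).filter p, g n‖ ≤ B)
    (hf1 : ∀ n : ℤ, ‖f n‖ ≤ 1)
    (hvar : ∀ n : ℤ, x₁ < n → ‖f (n + 1) - f n‖ ≤ φ n - φ (n + 1)) :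
    ‖∑ n ∈ (Ioc x₁ (x₁ + K)).filter p, g n * f n‖ ≤ B * (1 + (φ (x₁ + 1) - φ (x₁ + K))) := by
  rw [kfw_sum_Ioc_filter_eq_sum_range]
  set a : ℕ → ℂ := fun i => if p (x₁ + 1 + i) then g (x₁ + 1 + i) else 0 with ha
  set w : ℕ → ℂ := fun i => f (x₁ + 1 + i) with hw
  have hsummand : ∀ i : ℕ, (if p (x₁ + 1 + i) then g (x₁ + 1 + i) * f (x₁ + 1 + i) else 0) =
      a i * w i := by
    intro i; simp only [ha, hw]; split_ifs <;> simp
  simp_rw [hsummand]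
  have hpartial' : ∀ k, k ≤ K → ‖∑ i ∈ Finset.range k, a i‖ ≤ B := by
    intro k hk
    have := hpartial k hk
    rw [kfw_sum_Ioc_filter_eq_sum_range] at this
    exact this
  have habel := Literature.NumberTheory.Sieve.Iwaniec1978.norm_sum_mul_le_of_partialSums
    (n := K) (a := a) (w := w) hpartial'
  refine habel.trans ?_
  refine mul_le_mul_of_nonneg_left ?_ hB
  -- `‖w(K-1)‖ ≤ 1` and the variation telescopes
  have hwn : ‖w (K - 1)‖ ≤ 1 := hf1 _
  have hvar' : ∑ i ∈ Finset.range (K - 1), ‖w (i + 1) - w i‖ ≤ φ (x₁ + 1) - φ (x₁ + K) := by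
    · -- telescoping sum of `φ(x₁+1+i) - φ(x₁+2+i)`
      have hle : ∑ i ∈ Finset.range (K - 1), ‖w (i + 1) - w i‖ ≤
          ∑ i ∈ Finset.range (K - 1), (φ (x₁ + 1 + i) - φ (x₁ + 1 + (i + 1 : ℕ))) := by
        refine Finset.sum_le_sum fun i _ => ?_
        simp only [hw]
        have := hvar (x₁ + 1 + i) (by omega)
        have e1 : x₁ + 1 + ((i + 1 : ℕ) : ℤ) = x₁ + 1 + i + 1 := by push_cast; ring
        rw [e1]
        exact this
      refine hle.trans ?_
      have htel : ∀ m : ℕ, ∑ i ∈ Finset.range m, (φ (x₁ + 1 + i) - φ (x₁ + 1 + (i + 1 : ℕ))) =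
          φ (x₁ + 1) - φ (x₁ + 1 + m) := by
        intro m
        induction m with
        | zero => simp
        | succ m ih =>
            rw [Finset.sum_range_succ, ih]
            push_cast
            ring
      rw [htel]
      have e2 : x₁ + 1 + ((K - 1 : ℕ) : ℤ) = x₁ + K := by
        rw [Nat.cast_sub hK]; push_cast; ring
      rw [e2]
  linarith

/-- The twist `f(n) = e(θ/n)` (`n ≥ 1`): `‖f(n+1) - f(n)‖ ≤ 2π|θ| (1/n - 1/(n+1))`. [folklore] -/
theorem kfw_twist_variation (θ : ℝ) {n : ℤ} (hn : 0 < n) :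
    ‖Complex.exp (2 * Real.pi * Complex.I * (θ / ((n + 1 : ℤ) : ℂ))) -
        Complex.exp (2 * Real.pi * Complex.I * (θ / (n : ℂ)))‖ ≤
      2 * Real.pi * |θ| * (1 / (n : ℝ) - 1 / ((n : ℝ) + 1)) := by
  have hn' : (0 : ℝ) < n := by exact_mod_cast hn
  have hn1 : (0 : ℝ) < n + 1 := by linarith
  -- factor out `e(θ/n)`
  have hfac : Complex.exp (2 * Real.pi * Complex.I * (θ / ((n + 1 : ℤ) : ℂ))) -
      Complex.exp (2 * Real.pi * Complex.I * (θ / (n : ℂ))) =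
      Complex.exp (2 * Real.pi * Complex.I * (θ / (n : ℂ))) *
        (Complex.exp (Complex.I * ((2 * Real.pi * (θ / ((n : ℝ) + 1) - θ / n) : ℝ) : ℂ)) - 1) := by
    rw [mul_sub, mul_one, ← Complex.exp_add]
    congr 2
    push_cast
    ring
  rw [hfac, norm_mul]
  have h1 : ‖Complex.exp (2 * Real.pi * Complex.I * (θ / (n : ℂ)))‖ = 1 := by
    have : 2 * (Real.pi : ℂ) * Complex.I * (θ / (n : ℂ)) = ((2 * Real.pi * (θ / n) : ℝ) : ℂ) * Complex.I := by
      push_cast; ring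
    rw [this, Complex.norm_exp_ofReal_mul_I]
  rw [h1, one_mul]
  refine (Real.norm_exp_I_mul_ofReal_sub_one_le).trans ?_
  rw [Real.norm_eq_abs]
  have hdiff : θ / ((n : ℝ) + 1) - θ / n = -(θ * (1 / (n : ℝ) - 1 / ((n : ℝ) + 1))) := by
    field_simp; ring
  have hpos : 0 ≤ 1 / (n : ℝ) - 1 / ((n : ℝ) + 1) := by
    rw [sub_nonneg]; exact one_div_le_one_div_of_le hn' (by linarith)
  rw [hdiff, mul_neg, abs_neg,
    show 2 * Real.pi * (θ * (1 / (n : ℝ) - 1 / ((n : ℝ) + 1))) =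
      (2 * Real.pi) * θ * (1 / (n : ℝ) - 1 / ((n : ℝ) + 1)) by ring,
    abs_mul, abs_mul, abs_of_nonneg hpos, abs_of_pos Real.two_pi_pos]

end Literature.NumberTheory.LFunctions

end
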